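/-
Copyright (c) 2026. All rights reserved.
Released under Apache 2.0 license as described in the file LICENSE.
Authors: abc-iut cell, prover seat abc-iut-w4-d095 (wave 4, gen 5), over the MLF model categories of abc-iut-L4-t9 and the
Def 3.1 vocabulary of abc-iut-L4-t2 (see the imports).
-/
import Literature.AnabelianGeometry.AbsoluteAnabelian.AbsTopIII.MLFGaloisModelCategories
import Mathlib.Topology.Algebra.Group.Quotient
import Mathlib.Algebra.Module.PUnit
import HarnessLib

/-!
# [AbsTopIII] Def 3.1 (ii)/(iii), Def 5.6 (ii)(b), (iii): the mono-analyticization functors AT THE MLF MODEL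

S. Mochizuki, *Topics in absolute anabelian geometry III: global reconstruction algorithms*, J. Math. Sci. Univ.
Tokyo 22 (2015) 939–1156 [MochizukiAbsTopIII2015]; locators = pages of the author's manuscript
(`paper:url-5493eb38cbb7`), read on the page: Def 3.1 (ii) p. 67 ("the surjection `Π ↠ G` determined by the action of
`Π` on `M`" = the Galois augmentation, `G` the arithmetic Galois group; "of mono-analytic type": the augmentation is an
isomorphism; a morphism of pairs "induces an open injective homomorphism between the respective arithmetic Galois
groups"), Def 3.1 (iii) p. 68 (`𝒞^{MLF⊢}_T ⊆ 𝒞^{MLF}_T`, the functors `(Π ↷ M) ↦ Π` to `𝒯𝔾`), Def 5.6 (ii) p. 135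
(mono-analytic Galois-theaters, (b): "`G_w` is isomorphic to the [group-theoretically characterizable — cf. Remark
1.9.2] quotient `Π_v ↠ G_v` determined by the absolute Galois group of the base field"; the mono-analyticization
functors `Th• → Th⊢`), Def 5.6 (iii) pp. 135–136 (the 1-commutative diagram `𝒞^{MLF-sB}_{TS⊞} → 𝒞^{MLF-sB}_{TS} → 𝒯𝔾^{sB}`
over `𝒞^{MLF⊢}_{TS⊞} → 𝒞^{MLF⊢}_{TS} → 𝒯𝔾⊢`, "in which the vertical arrows are “mono-analyticization functors” [cf. the
mono-analyticization functors of (ii); the construction implicit in (ii), (b)]"),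
Prop 5.8 (vii) p. 141.

Kernel CONSTRUCTIONS (no `Prop` facts) over abc-iut-L4-t9's model categories `TFModel p` (= `𝒳`, model MLF-Galois
`TF`-pairs `(Π_k ↠ G_k ↷ ℚ̄_p)`, Galois-isomorphisms), `TSObj` (= `𝒞_TS`-shaped pairs) and `TopGroupObj`
(= double-underlined `𝒯𝔾`):

* `quotientMap_injective/bijective/continuous/isOpenMap`, `quotientIso` — a Galois-isomorphism of pairs `φ_Π` with
  `φ_Π⁻¹(Ker₂) = Ker₁` induces an isomorphism of topological groups of the ARITHMETIC QUOTIENTS `Π₁/Ker₁ ⥲ Π₂/Ker₂`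
  (quotient topologies) — the "induced homomorphism between the respective arithmetic Galois groups" of Def 3.1 (ii);
* `TSObj.monoAn : 𝒞_TS ⥤ 𝒞_TS` — **the mono-analyticization of `TS`-pairs** (middle vertical arrow of Def 5.6 (iii)):
  `(Π ↷ M) ↦ (G ↷ M)`, `G := Π/Ker(Π → Aut(M))` acting through the faithful action it inherits; its values are pairs
  "of mono-analytic type" (`TSObj.actionKer_monoAn`: trivial action kernel, i.e. the Galois augmentation of `(G ↷ M)`
  is an isomorphism);
* `TFModel.monoGal : 𝒳 ⥤ 𝒯𝔾` — **`W ↦ G_w` at an MLF** (Def 5.6 (ii)(b)): `(Π_k ↠ G_k ↷ ℚ̄_p) ↦ Π_k/Ker`, where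
  `Ker = Ker(ε_k)` (`TFModel.actionKer_pair_eq`: `G_k` acts faithfully on `k̄`), i.e. the arithmetic Galois group AS THE
  QUOTIENT OF `Π_k` it is recovered as (print: "the quotient `Π_k ↠ G_k` may be recovered as the image of the
  homomorphism `Π_k → Aut(M_k)` arising from the action of (c)", Def 3.1 (i));
* `TopGroupObj.trivialTS : 𝒯𝔾 ⥤ 𝒞_TS`, `G ↦ (G ↷ pt)` — a CANONICAL PLACEHOLDER target for the forgetful functors
  `ψ^{An⊢⊞}_{w,ν}` of Prop 5.8 (vii) (print: from the mono-anabelian containers `G ↷ 𝒪^×(G)`, `G ↷ k~(G)` of Prop 5.8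
  (i)–(iii), whose construction is local class field theory — FACT-LIST; not built here).

Consumed by `LogFrobeniusMonoGenuineModel.lean` (the §5 setting with genuine mono-analytic rows; Cor 5.10 (iv)(a) at
it).  (Doc-only v2: quotations restored to print's wording — brackets and scare quotes kept, no silent elisions —
after referee lane L12's n26 style ruling; declarations byte-identical.)  HONEST FRAMING: refereed pre-IUT material; a MODEL (kernel definitions) over the cell's MLF model, not a
discharge of any reconstruction claim; nothing here bears on [IUTchIII] Cor. 3.12; no side taken.
-/

set_option autoImplicit false

noncomputable section

open CategoryTheory Topology

namespace Literature.AnabelianGeometry.AbsoluteAnabelian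

namespace AbsTopIII

/-! ## Part 1. Induced isomorphisms of arithmetic quotients -/

section QuotientTransport

variable {G H : Type} [Group G] [Group H] (N : Subgroup G) [N.Normal] (M : Subgroup H) [M.Normal] (φ : G →* H)

/-- If `φ⁻¹(M) = N` then the induced homomorphism `G/N → H/M` is injective ("induces an open injective homomorphism
between the respective arithmetic Galois groups", Def 3.1 (ii); the openness half is `quotientMap_isOpenMap`).
[cite: MochizukiAbsTopIII2015, Definition 3.1 (ii) p.67] -/
theorem quotientMap_injective (h : M.comap φ = N) :
    Function.Injective (QuotientGroup.map N M φ h.ge) := by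
  rw [← MonoidHom.ker_eq_bot_iff, QuotientGroup.ker_map, h, eq_bot_iff]
  rintro _ ⟨x, hx, rfl⟩
  exact (QuotientGroup.eq_one_iff x).mpr hx

/-- If moreover `φ` is surjective, the induced homomorphism of arithmetic quotients is bijective.
[cite: MochizukiAbsTopIII2015, Definition 3.1 (ii) p.67] -/
theorem quotientMap_bijective (h : M.comap φ = N) (hφ : Function.Surjective φ) :
    Function.Bijective (QuotientGroup.map N M φ h.ge) :=
  ⟨quotientMap_injective N M φ h,
    QuotientGroup.map_surjective_of_surjective N M φ (QuotientGroup.mk_surjective.comp hφ) h.ge⟩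

variable [TopologicalSpace G] [TopologicalSpace H]

/-- The induced homomorphism of arithmetic quotients is continuous for the quotient topologies when `φ` is.
[cite: MochizukiAbsTopIII2015, Definition 3.1 (ii) p.67] -/
theorem quotientMap_continuous [IsTopologicalGroup G] (h : N ≤ M.comap φ) (hφ : Continuous φ) :
    Continuous (QuotientGroup.map N M φ h) := by
  rw [← (QuotientGroup.isOpenQuotientMap_mk (N := N)).continuous_comp_iff]
  exact QuotientGroup.continuous_mk.comp hφ

/-- The induced homomorphism of arithmetic quotients is open when `φ` is open.
[cite: MochizukiAbsTopIII2015, Definition 3.1 (ii) p.67] -/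
theorem quotientMap_isOpenMap [IsTopologicalGroup H] (h : N ≤ M.comap φ) (hφ : IsOpenMap φ) :
    IsOpenMap (QuotientGroup.map N M φ h) := by
  intro U hU
  have hsurj : Function.Surjective (QuotientGroup.mk : G → G ⧸ N) := QuotientGroup.mk_surjective
  have himg : (QuotientGroup.map N M φ h) '' U = (QuotientGroup.mk ∘ φ) '' (QuotientGroup.mk ⁻¹' U) := by
    conv_lhs => rw [← Set.image_preimage_eq U hsurj]
    rw [Set.image_image]
    rfl
  rw [himg]
  exact (QuotientGroup.isOpenMap_coe.comp hφ) _ (hU.preimage QuotientGroup.continuous_mk)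

/-- **The isomorphism of arithmetic Galois groups induced by a Galois-isomorphism of pairs**: for `φ : Π₁ ⥲ Π₂`
bijective, continuous and open with `φ⁻¹(Ker₂) = Ker₁`, the induced `Π₁/Ker₁ ⥲ Π₂/Ker₂` is an isomorphism of
topological groups. [cite: MochizukiAbsTopIII2015, Definition 3.1 (ii) p.67] -/
def quotientIso [IsTopologicalGroup G] [IsTopologicalGroup H] (h : M.comap φ = N) (hc : Continuous φ)
    (hb : Function.Bijective φ) (ho : IsOpenMap φ) : G ⧸ N ≃ₜ* H ⧸ M :=
  ContinuousMulEquiv.mk'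
    ((Equiv.ofBijective _ (quotientMap_bijective N M φ h hb.2)).toHomeomorphOfContinuousOpen
      (quotientMap_continuous N M φ h.ge hc) (quotientMap_isOpenMap N M φ h.ge ho))
    (map_mul (QuotientGroup.map N M φ h.ge))

/-- `quotientIso` is the induced map `QuotientGroup.map` as a function. [cite: MochizukiAbsTopIII2015, Definition 3.1 (ii) p.67] -/
@[simp] theorem quotientIso_apply [IsTopologicalGroup G] [IsTopologicalGroup H] (h : M.comap φ = N)
    (hc : Continuous φ) (hb : Function.Bijective φ) (ho : IsOpenMap φ) (x : G ⧸ N) : quotientIso N M φ h hc hb ho x = QuotientGroup.map N M φ h.ge x := rfl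

end QuotientTransport

/-! ## Part 2. The mono-analyticization of `TS`-pairs: `(Π ↷ M) ↦ (G ↷ M)` (Def 5.6 (iii), Def 3.1 (ii)) -/

namespace TSObj

/-- The action kernel of a `TS`-pair is a normal subgroup (a kernel). [cite: MochizukiAbsTopIII2015, Definition 3.1 (ii) p.67] -/
instance actionKer_normal (P : TSObj) : P.actionKer.Normal := by
  unfold actionKer; infer_instance

/-- **The pair of mono-analytic type attached to a `TS`-pair**: `(G ↷ M)` with `G := Π/Ker(Π → Aut(M))` the arithmetic
Galois group (quotient topology) acting through the faithful action it inherits.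
[cite: MochizukiAbsTopIII2015, Definition 3.1 (ii) p.67] -/
def monoPair (P : TSObj) : GaloisSpacePair.{0} where
  Pi := P.pair.Pi ⧸ P.actionKer
  M := P.pair.M
  instAction := MulAction.compHom P.pair.M (QuotientGroup.kerLift (MulAction.toPermHom P.pair.Pi P.pair.M))
  continuous_smul := by
    letI : MulAction (P.pair.Pi ⧸ P.actionKer) P.pair.M :=
      MulAction.compHom P.pair.M (QuotientGroup.kerLift (MulAction.toPermHom P.pair.Pi P.pair.M))
    have hq := (QuotientGroup.isOpenQuotientMap_mk (N := P.actionKer)).prodMap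
      (IsOpenQuotientMap.id : IsOpenQuotientMap (id : P.pair.M → P.pair.M))
    rw [← hq.continuous_comp_iff]
    exact P.pair.continuous_smul

/-- In the mono-analytic pair, the class of `g` acts as `g`. [cite: MochizukiAbsTopIII2015, Definition 3.1 (ii) p.67] -/
@[simp] theorem monoPair_mk_smul (P : TSObj) (g : P.pair.Pi) (x : P.pair.M) :
    (show (monoPair P).Pi from (QuotientGroup.mk g : P.pair.Pi ⧸ P.actionKer)) • (show (monoPair P).M from x) =
      (show (monoPair P).M from g • x) := rfl

/-- The mono-analyticization on objects. [cite: MochizukiAbsTopIII2015, Definition 5.6 (iii) p.135] -/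
def monoObj (P : TSObj) : TSObj := ⟨monoPair P⟩

/-- **"Of mono-analytic type"**: the arithmetic Galois group of the mono-analyticized pair is the whole group, i.e. its
action kernel is trivial (the Galois augmentation `G ↠ G` is an isomorphism). [cite: MochizukiAbsTopIII2015, Definition 3.1 (ii) p.67] -/
theorem actionKer_monoObj (P : TSObj) : (monoObj P).actionKer = ⊥ := by
  rw [eq_bot_iff]
  intro x hx
  rw [Subgroup.mem_bot]
  induction x using QuotientGroup.induction_on with
  | H g =>
    change (QuotientGroup.mk g : P.pair.Pi ⧸ P.actionKer) = 1
    rw [QuotientGroup.eq_one_iff, mem_actionKer_iff]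
    exact fun m => (mem_actionKer_iff _ _).mp hx m

/-- The mono-analyticization on morphisms: a Galois-isomorphism `(φ_Π, φ_M)` of `TS`-pairs induces the isomorphism of
arithmetic Galois groups `G₁ ⥲ G₂` (by `comap_ker`) together with the same `φ_M`.
[cite: MochizukiAbsTopIII2015, Definition 5.6 (iii) p.135] -/
def monoMap {P Q : TSObj} (φ : P ⟶ Q) : monoObj P ⟶ monoObj Q where
  homPi := QuotientGroup.map P.actionKer Q.actionKer (φ : Hom P Q).homPi (φ : Hom P Q).comap_ker.ge
  continuous_homPi := quotientMap_continuous _ _ _ _ (φ : Hom P Q).continuous_homPi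
  bijective_homPi := quotientMap_bijective _ _ _ (φ : Hom P Q).comap_ker (φ : Hom P Q).bijective_homPi.2
  isOpenMap_homPi := quotientMap_isOpenMap _ _ _ _ (φ : Hom P Q).isOpenMap_homPi
  homM := (φ : Hom P Q).homM
  continuous_homM := (φ : Hom P Q).continuous_homM
  smul_comm g x := by
    induction g using QuotientGroup.induction_on with
    | H g => exact (φ : Hom P Q).smul_comm g x
  comap_ker := by
    rw [actionKer_monoObj, actionKer_monoObj, MonoidHom.comap_bot, MonoidHom.ker_eq_bot_iff]
    exact quotientMap_injective _ _ _ (φ : Hom P Q).comap_ker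

/-- **The mono-analyticization functor on `TS`-pairs** `𝒞_TS → 𝒞^{⊢}_TS ⊆ 𝒞_TS` (the middle vertical arrow of the
1-commutative diagram of Def 5.6 (iii)): `(Π ↷ M) ↦ (G ↷ M)`. [cite: MochizukiAbsTopIII2015, Definition 5.6 (iii) p.135] -/
def monoAn : TSObj ⥤ TSObj where
  obj := monoObj
  map := monoMap
  map_id P := by
    refine Hom.ext ?_ rfl
    exact QuotientGroup.monoidHom_ext _ (by ext; rfl)
  map_comp φ ψ := by
    refine Hom.ext ?_ rfl
    exact QuotientGroup.monoidHom_ext _ (by ext; rfl)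

/-- `monoAn` keeps the space `M`. [cite: MochizukiAbsTopIII2015, Definition 5.6 (iii) p.135] -/
@[simp] theorem monoAn_obj_M (P : TSObj) : (monoAn.obj P).pair.M = P.pair.M := rfl

/-- `monoAn` replaces `Π` by its arithmetic quotient. [cite: MochizukiAbsTopIII2015, Definition 5.6 (iii) p.135] -/
@[simp] theorem monoAn_obj_Pi (P : TSObj) : (monoAn.obj P).pair.Pi = (P.pair.Pi ⧸ P.actionKer) := rfl

/-- `monoAn` lies over `(Π ↷ M) ↦ G` on Galois groups: `φ_Π ↦` the induced map of arithmetic quotients.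
[cite: MochizukiAbsTopIII2015, Definition 5.6 (iii) p.135] -/
@[simp] theorem monoAn_map_homPi_mk {P Q : TSObj} (φ : P ⟶ Q) (g : P.pair.Pi) :
    (monoAn.map φ : Hom _ _).homPi (QuotientGroup.mk g) = QuotientGroup.mk ((φ : Hom P Q).homPi g) := rfl

/-- Every mono-analyticized pair is of mono-analytic type (trivial action kernel).
[cite: MochizukiAbsTopIII2015, Definition 3.1 (ii) p.67] -/
theorem actionKer_monoAn (P : TSObj) : (monoAn.obj P).actionKer = ⊥ := actionKer_monoObj P

end TSObj

/-! ## Part 3. The mono-analyticization of the base at an MLF: `(Π_k ↠ G_k ↷ ℚ̄_p) ↦ Π_k/Ker` (Def 5.6 (ii)(b)) -/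

namespace TFModel

variable (p : ℕ) [Fact p.Prime]

/-- The action kernel of the model pair is a normal subgroup. [cite: MochizukiAbsTopIII2015, Definition 3.1 (ii) p.67] -/
instance actionKer_normal (A : TFModel p) : A.pair.actionKer.Normal := by
  unfold GaloisFieldPair.actionKer; infer_instance

variable {p} in
/-- In the model, the action kernel of `(Π_k ↷ ℚ̄_p)` is the kernel of the augmentation `ε_k : Π_k ↠ G_k` (`G_k` acts
faithfully on `k̄`): "the quotient `Π_k ↠ G_k` may be recovered as the image of the homomorphism `Π_k → Aut(M_k)`
arising from the action of (c)".
[cite: MochizukiAbsTopIII2015, Definition 3.1 (i) p.67] -/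
theorem actionKer_pair_eq (A : TFModel p) : A.pair.actionKer = A.D.aug.ker := by
  ext g
  change g ∈ A.pair.actionKer ↔ A.D.aug g = 1
  rw [AlgEquiv.ext_iff]
  simp only [GaloisFieldPair.actionKer, MonoidHom.mem_ker, RingEquiv.ext_iff, MulSemiringAction.toRingAut_apply,
    MulSemiringAction.toRingEquiv_apply_apply, RingAut.one_apply, AlgEquiv.one_apply]
  exact Iff.rfl

/-- **`W ↦ G_w` at an MLF** (Def 5.6 (ii)(b)): the functor `𝒳 → 𝒯𝔾`, `(Π_k ↠ G_k ↷ ℚ̄_p) ↦ Π_k/Ker(ε_k)` — the arithmetic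
Galois group as the quotient of `Π_k` it is "group-theoretically" (here: action-theoretically) recovered as — with the
induced isomorphisms of arithmetic quotients on Galois-isomorphisms of pairs.
[cite: MochizukiAbsTopIII2015, Definition 5.6 (ii) p.135] -/
def monoGal : TFModel p ⥤ TopGroupObj where
  obj A := ⟨A.pair.Pi ⧸ A.pair.actionKer⟩
  map {A B} f := ⟨quotientIso A.pair.actionKer B.pair.actionKer (f : Hom A B).hom.homPi (f : Hom A B).hom.comap_ker
    (f : Hom A B).hom.continuous_homPi (f : Hom A B).bijective (f : Hom A B).isOpenMap⟩
  map_id A := TopGroupObj.Hom.ext fun x => by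
    induction x using QuotientGroup.induction_on with
    | H g => rfl
  map_comp f g := TopGroupObj.Hom.ext fun x => by
    induction x using QuotientGroup.induction_on with
    | H g => rfl

/-- `monoGal` on objects: the arithmetic quotient of `Π_k`. [cite: MochizukiAbsTopIII2015, Definition 5.6 (ii) p.135] -/
@[simp] theorem monoGal_obj_G (A : TFModel p) : ((monoGal p).obj A).G = (A.pair.Pi ⧸ A.pair.actionKer) := rfl

variable {p} in
/-- `monoGal` on morphisms: `φ_Π` descended to the arithmetic quotients. [cite: MochizukiAbsTopIII2015, Definition 5.6 (ii) p.135] -/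
@[simp] theorem monoGal_map_iso_mk {A B : TFModel p} (f : A ⟶ B) (g : A.pair.Pi) :
    ((monoGal p).map f).iso (QuotientGroup.mk g) = QuotientGroup.mk ((f : Hom A B).hom.homPi g) := rfl

end TFModel

/-! ## Part 4. The placeholder telecore target `G ↦ (G ↷ pt)` -/

namespace TopGroupObj

/-- The `TS`-pair `(G ↷ pt)` of a topological group — PLACEHOLDER for the mono-anabelian containers `G ↷ 𝒪^×(G)` of
Prop 5.8 (whose construction is local class field theory). [cite: MochizukiAbsTopIII2015, Proposition 5.8 (vii) p.141] -/
def trivialPair (A : TopGroupObj) : GaloisSpacePair.{0} where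
  Pi := A.G
  M := PUnit
  instAction := inferInstance
  continuous_smul := continuous_const

/-- The action kernel of `(G ↷ pt)` is everything. [cite: MochizukiAbsTopIII2015, Definition 3.1 (ii) p.67] -/
theorem actionKer_trivialPair (A : TopGroupObj) : (⟨trivialPair A⟩ : TSObj).actionKer = ⊤ := by
  rw [eq_top_iff]
  intro g _
  rw [TSObj.mem_actionKer_iff]
  intro x
  rfl

/-- `G ↦ (G ↷ pt)` as a functor `𝒯𝔾 → 𝒞_TS` (isomorphisms of topological groups act by themselves on `G` and by the
identity on the point). [cite: MochizukiAbsTopIII2015, Proposition 5.8 (vii) p.141] -/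
def trivialTS : TopGroupObj ⥤ TSObj where
  obj A := ⟨trivialPair A⟩
  map {A B} f :=
    { homPi := (f : Hom A B).iso.toMonoidHom
      continuous_homPi := (f : Hom A B).iso.continuous
      bijective_homPi := (f : Hom A B).iso.bijective
      isOpenMap_homPi := (f : Hom A B).iso.toHomeomorph.isOpenMap
      homM := id
      continuous_homM := continuous_id
      smul_comm := fun _ _ => rfl
      comap_ker := by rw [actionKer_trivialPair, actionKer_trivialPair, Subgroup.comap_top] }
  map_id A := TSObj.Hom.ext (MonoidHom.ext fun _ => rfl) rfl
  map_comp f g := TSObj.Hom.ext (MonoidHom.ext fun _ => rfl) rfl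

end TopGroupObj

end AbsTopIII

end Literature.AnabelianGeometry.AbsoluteAnabelian

end
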